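import Summits.QuantumFields.YangMills.Theorems.BalabanLadderIRColdPressurePincerDefs
import Summits.QuantumFields.YangMills.Theorems.BalabanLadderIRLightCodePincer
import Summits.QuantumFields.YangMills.Theorems.PencilRigidityWeakCouplingHypercubicLimitColdPressureClustering
import Summits.QuantumFields.YangMills.Theses.BalabanLadder
import Literature.MathematicalPhysics.QuantumFieldTheory.Balaban1983to89.InfiniteVolumeSufficientXII
import HarnessLib

/-!
# Route `BalabanLadder`, crux `IR` (stmt-QuantumFields-19354): the COLD-PRESSURE PINCER — seams, `IR` BY NAME, rung, repair

Proofs of the crux-idea card `Cruxes/IR/Ideas/ym19354-5-cold-pressure-pincer.md` (seat `ym-cruxidea-19354-5` gen 2; sketch of record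
`Sketch-g2.lean` sha16 `d0296864a2f25cb8`, evidence #49 on stmt-QuantumFields-19354), landed as helper modules per the route
owner's LANDABLE-NOW list R19 (8) «cold-pressure seams … as idle work» (ym-beyond-p2 g24) by ★ym-osasm-p1 g7, `--supports
stmt-QuantumFields-19354` (helper; no registered stub of 19354 is claimed — the slot of record is `af-pincer-T`).

* §1 `cp_pinned` — the pincer (af-pincer's `onset_pinned` shape with the cold-pressure length as the scale:
  `LowerBounds`(i) + X_cp ⇒ `a β · ξ⋆(β) < T` eventually); the volume floor `u³e^{−u} → 0` is the landed
  `FluxCodeBlindness.volumeFloor_eventually` (`BalabanLadderIRLightCodePincer`, same statement — imported, not restated);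
  `gapInUnits_of_coldPressure_pinned` — the rate seam: a COROLLARY of the landed
  `TraceNormColdPressure.abs_latticeConnectedCorr_le_of_coldPressure` with `μ := a β / T`, `K := 1` and a per-β size threshold
  (the constant `max(C_A C_B e^{2w}·7, 2 C_A C_B e^{2w})` never sees `C₀(β)`, `S₁(β)`, `ξ⋆(β)`): `GapInUnits G r a`, `c₁ = 1/T`.
* §2 `IR_of_cp : ColdPressureOnset → AFToColdPressure → Theses.BalabanLadder.IR` (IR BY NAME; CONDITIONAL on the two open
  stub statements; `ColdPressureOnset` over ALL simple `G` is refuted mod `LightFluxMode SO(3)` —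
  `IR/Negative/ColdPressureOnsetFalseOfLightFlux` — hence §4).
* §3 FORMAT RUNG at strong coupling (every compact metrisable `G`): `coldPressureAt_strongCoupling : 0 ≤ β ≤
  strongCouplingRadius ρ → ColdPressureAt r.ρ β 8`, by name from the tree's Kotecký–Preiss rung
  `Missing.coldFreeEnergyBound_of_strongCoupling` ∕ `coldTraceBound_of_coldFreeEnergyBound` ∕ `coldPressureBound_of_coldTraceBound`.
* §4 THE REPAIR: `IR_of_cases : IRsc → IRnsc → IR` (kernel-trivial split on `SimplyConnectedSpace G`), `IRsc_of_cp`,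
  `IR_of_cp_repaired : ColdPressureOnsetSC → AFToColdPressure → IRnsc → IR` — the free-energy currency buys the simply-connected
  half; `IRnsc` is carried OPEN (its currency is the gen-3 light code, `BalabanLadderIRLightCodePincer.IR_of_lightCodePincer`).

HONEST FRAMING: kernel bookkeeping of CONDITIONAL reductions (open stub statements as hypotheses); 0 legs discharged; not a
gap claim.  Refs: card; Osterwalder–Seiler 1978 §3; the landed `q = 0` seam p127195-lineage
(`PencilRigidityWeakCouplingHypercubicLimitColdPressureClustering`).
-/

set_option autoImplicit false

noncomputable section

open Filter Topology MeasureTheory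
open scoped SchwartzMap
open Literature.MathematicalPhysics.QuantumFieldTheory Literature.MathematicalPhysics.QuantumLattice
open Summit.QuantumFields.YangMills.Cruxes.OSLegsFromFemtoAndGap.DlrCollarTransfer (GapInUnits LowerBounds Q2)
open Literature.MathematicalPhysics.QuantumFieldTheory.Balaban1983to89.Sufficient (ColdPressureBound)
open Literature.MathematicalPhysics.QuantumFieldTheory.Balaban1983to89.Sufficient (ColdTraceBound
  coldPressureBound_of_coldTraceBound)
open Literature.MathematicalPhysics.QuantumFieldTheory.Balaban1983to89.Missing (ColdFreeEnergyBound
  strongCouplingRadius coldFreeEnergyBound_of_strongCoupling coldTraceBound_of_coldFreeEnergyBound)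
open Summit.QuantumFields.YangMills.Theorems.WeakCouplingHypercubicLimit.TraceNormColdPressure
  (abs_latticeConnectedCorr_le_of_coldPressure)
open Summit.QuantumFields.YangMills.Cruxes.IR.FluxCodeBlindness (volumeFloor_eventually)

namespace Summit.QuantumFields.YangMills.Cruxes.IR.ColdPressurePincer

/-! ## §1 The seams: the pincer, the volume floor, the rate seam -/

section Seams

variable {G : Type} [Group G] [TopologicalSpace G] [IsTopologicalGroup G] [CompactSpace G]
  [MeasurableSpace G] [BorelSpace G]

/-- **The pincer (PROVED; verbatim `af-pincer`'s `onset_pinned` with the cold-pressure length as the scale).**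
`LowerBounds`(i) gives `Q2(a β; Θv, v) ≥ ε₅` for `β ≥ β₅` on all tori with `a β · L ≥ Λ₅`; X_cp at `η = ε₅/2` gives
`|Q2(s; Θv, v)| ≤ ε₅/2` frequently in `L` whenever `T ≤ s · ξ⋆(β)`.  Hence `a β · ξ⋆(β) < T` for all large `β`. -/
theorem cp_pinned (r : LatticeRep G) (a : ℝ → ℝ) (ha : ∀ β, 0 < a β) (hlb : LowerBounds G r a)
    (hX : ∀ v : 𝓢(EuclideanSpace ℝ (Fin 4), ℝ), tsupport v ⊆ {y : EuclideanSpace ℝ (Fin 4) | 0 < y 0} →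
      ∀ η : ℝ, 0 < η → ∃ T β₁ : ℝ, ∀ β : ℝ, β₁ ≤ β → ∀ s : ℝ, 0 < s →
        T ≤ s * (cpLength r.ρ β : ℝ) →
          ∃ᶠ (L : ℕ) in atTop, |Q2 G r β L s (thetaTest 4 v) v| ≤ η) :
    ∃ T β₆ : ℝ, ∀ β : ℝ, β₆ ≤ β → a β * (cpLength r.ρ β : ℝ) < T := by
  obtain ⟨⟨v, ε₅, β₅, Λ₅, hv, hε₅, hlow⟩, -⟩ := hlb
  obtain ⟨T, β₁, hT⟩ := hX v hv (ε₅ / 2) (half_pos hε₅)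
  refine ⟨T, max β₁ β₅, fun β hβ => ?_⟩
  have hβ1 : β₁ ≤ β := le_trans (le_max_left _ _) hβ
  have hβ5 : β₅ ≤ β := le_trans (le_max_right _ _) hβ
  by_contra hge
  rw [not_lt] at hge
  have hfreq := hT β hβ1 (a β) (ha β) hge
  have hev : ∀ᶠ (L : ℕ) in atTop, Λ₅ ≤ a β * (L : ℝ) :=
    (tendsto_natCast_atTop_atTop.const_mul_atTop (ha β)).eventually_ge_atTop Λ₅
  obtain ⟨L, hL1, hL2⟩ := (hfreq.and_eventually hev).exists
  have hlo := hlow β hβ5 L hL2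
  have habs := le_abs_self (Q2 G r β L (a β) (thetaTest 4 v) v)
  linarith

/-- **The rate seam (PROVED): cold-pressure onset pinned below `T` lattice-units-per-unit gives `GapInUnits`.**
At each `β` past the thresholds, cold pressure holds at the length `ξ⋆(β) ∈ cpSet` with its own `(C₀(β), S₁(β))`;
`a β · ξ⋆(β) < T` makes the UNIFORM rate `μ(β) := a β / T` at most `1/ξ⋆(β)` (and `≤ 1` once `a β ≤ T`, which
`a → 0` provides); the per-β volume floor with `K = 1` holds beyond some `S₀(β)`.  The landed
`abs_latticeConnectedCorr_le_of_coldPressure` then bounds every connected pair by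
`max(C_A C_B e^{2w}·7, 2 C_A C_B e^{2w}) · e^{−(a β/T) n}` — a constant that sees neither `β` nor `C₀(β)`:
`GapInUnits G r a` with `c₁ = 1/T`, `S₁ β = max (S₁(β)) (S₀(β))`. Pure bookkeeping over the tree. -/
theorem gapInUnits_of_coldPressure_pinned (r : LatticeRep G) (a : ℝ → ℝ) (ha : ∀ β, 0 < a β)
    (ha0 : Tendsto a atTop (𝓝 0)) {β₂ : ℝ}
    (hon : ∀ β : ℝ, β₂ ≤ β → ∃ ξ : ℕ, 1 ≤ ξ ∧ ColdPressureAt r.ρ β ξ)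
    {T β₆ : ℝ} (hpin : ∀ β : ℝ, β₆ ≤ β → a β * (cpLength r.ρ β : ℝ) < T) :
    GapInUnits G r a := by
  classical
  -- `T > 0`
  have hT : 0 < T := by
    have h1 := hpin (max β₂ β₆) (le_max_right _ _)
    have h0 : 0 ≤ a (max β₂ β₆) * (cpLength r.ρ (max β₂ β₆) : ℝ) :=
      mul_nonneg (ha _).le (Nat.cast_nonneg _)
    linarith
  -- eventually `a β ≤ T`
  obtain ⟨β₇, hβ₇⟩ : ∃ β₇ : ℝ, ∀ β : ℝ, β₇ ≤ β → a β ≤ T := by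
    have hev : ∀ᶠ β in atTop, a β < T := ha0.eventually (gt_mem_nhds hT)
    obtain ⟨β₇, h⟩ := Filter.eventually_atTop.1 hev
    exact ⟨β₇, fun β hβ => (h β hβ).le⟩
  set β₈ : ℝ := max (max β₂ β₆) (max β₇ 0) with hβ₈
  -- the per-β package at the uniform rate `a β / T`
  have hR : ∀ β : ℝ, β₈ ≤ β → ∃ S₂ : ℕ, ∃ C₀ : ℝ, 0 ≤ C₀ ∧
      (∀ S : ℕ, S₂ ≤ S → C₀ * ((2 * S + 1 : ℕ) : ℝ) ^ 3 * Real.exp (-(a β / T * S / 2)) ≤ 1) ∧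
      (∀ S : ℕ, S₂ ≤ S → ∀ m : ℕ, S + 1 ≤ 2 * (m + 2) →
        traceExcess r.ρ β (2 * S + 1) (m + 2) ≤
          C₀ * ((2 * S + 1 : ℕ) : ℝ) ^ 3 * Real.exp (-(a β / T * ((m + 2 : ℕ) : ℝ)))) := by
    intro β hβ
    have hβ2 : β₂ ≤ β := le_trans (le_trans (le_max_left _ _) (le_max_left _ _)) hβ
    have hβ6 : β₆ ≤ β := le_trans (le_trans (le_max_right _ _) (le_max_left _ _)) hβ
    obtain ⟨ξ, hξ, hcp⟩ := hon β hβ2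
    obtain ⟨h1, hcpL⟩ := cpLength_spec r.ρ β ⟨ξ, hξ, hcp⟩
    obtain ⟨C₀, S₁, hC₀, hP⟩ := hcpL
    have hμ0 : 0 < a β / T := div_pos (ha β) hT
    obtain ⟨S₀, hS₀⟩ := Filter.eventually_atTop.1 (volumeFloor_eventually C₀ (a β / T) hC₀ hμ0)
    refine ⟨max S₁ S₀, C₀, hC₀, fun S hS => hS₀ S (le_trans (le_max_right _ _) hS), fun S hS m hm => ?_⟩
    have hP1 := hP S (le_trans (le_max_left _ _) hS) m hm
    refine hP1.trans ?_
    have hV : 0 ≤ C₀ * ((2 * S + 1 : ℕ) : ℝ) ^ 3 := by positivity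
    refine mul_le_mul_of_nonneg_left (Real.exp_le_exp.2 ?_) hV
    have hξpos : (0 : ℝ) < (cpLength r.ρ β : ℝ) := by exact_mod_cast h1
    have hm0 : (0 : ℝ) ≤ ((m + 2 : ℕ) : ℝ) := Nat.cast_nonneg _
    have hpinβ : a β * (cpLength r.ρ β : ℝ) < T := hpin β hβ6
    have hrate : a β / T ≤ 1 / (cpLength r.ρ β : ℝ) := by
      rw [div_le_div_iff₀ hT hξpos]
      linarith
    have hmul : a β / T * ((m + 2 : ℕ) : ℝ) ≤ 1 / (cpLength r.ρ β : ℝ) * ((m + 2 : ℕ) : ℝ) :=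
      mul_le_mul_of_nonneg_right hrate hm0
    linarith
  -- the size threshold `S₁ β` (junk `0` below `β₈`)
  let S₁ : ℝ → ℕ := fun β => if h : β₈ ≤ β then Classical.choose (hR β h) else 0
  refine ⟨1 / T, β₈, S₁, by positivity, fun A B => ?_⟩
  obtain ⟨CA, hCA⟩ := A.bounded
  obtain ⟨CB, hCB⟩ := B.bounded
  obtain ⟨w, hw⟩ := abs_latticeConnectedCorr_le_of_coldPressure r A B hCA hCB
  refine ⟨max (CA * CB * Real.exp (2 * w) * (2 + 4 * 1 + 1 ^ 2)) (2 * (CA * CB) * Real.exp (2 * w)),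
    fun β hβ S n hS hn => ?_⟩
  have hS₁ : S₁ β = Classical.choose (hR β hβ) := dif_pos hβ
  obtain ⟨C₀, hC₀, hK, hP⟩ := Classical.choose_spec (hR β hβ)
  rw [hS₁] at hS
  have hβ0 : 0 ≤ β := le_trans (le_trans (le_max_right _ _) (le_max_right _ _)) hβ
  have hβ7 : β₇ ≤ β := le_trans (le_trans (le_max_left _ _) (le_max_right _ _)) hβ
  have hμ0 : 0 ≤ a β / T := (div_pos (ha β) hT).le
  have hμ1 : a β / T ≤ 1 := by
    rw [div_le_one hT]
    exact hβ₇ β hβ7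
  have hmain := hw β hβ0 (a β / T) C₀ 1 hμ0 hμ1 hC₀ _ hK hP S n hS hn
  have hexp : Real.exp (-(a β / T * n)) = Real.exp (-(1 / T * a β * n)) := by
    congr 1
    ring
  rw [hexp] at hmain
  exact hmain

end Seams

/-! ## §2 The composition to `IR` BY NAME -/

/-- **Composition: the spine's crux `IR` BY NAME from the two stub statements** (CONDITIONAL on `ColdPressureOnset` and
`AFToColdPressure`; through `cp_pinned` and `gapInUnits_of_coldPressure_pinned`).  NB `ColdPressureOnset` over all simple `G`
is refuted modulo `LightFluxMode SO(3)` (`IR/Negative/ColdPressureOnsetFalseOfLightFlux`); the repaired composition is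
`IR_of_cp_repaired` (§4). -/
theorem IR_of_cp (hI : ColdPressureOnset) (hX : AFToColdPressure) :
    Summit.QuantumFields.YangMills.Theses.BalabanLadder.IR := by
  intro G _ _ _ _ hG
  letI : MeasurableSpace G := borel G
  haveI : BorelSpace G := ⟨rfl⟩
  intro r a ha ha0 hlb
  obtain ⟨β₂, hon⟩ := hI G hG r
  obtain ⟨T, β₆, hpin⟩ := cp_pinned r a ha hlb (hX G hG r)
  exact gapInUnits_of_coldPressure_pinned r a ha ha0 hon hpin


/-! ## §3 FORMAT RUNG at strong coupling (every compact metrisable `G`): the stub-I_cp format is inhabited -/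

section Rung

variable {G : Type} [Group G] [TopologicalSpace G] [IsTopologicalGroup G] [CompactSpace G]
  [MeasurableSpace G] [BorelSpace G] [SecondCountableTopology G]

/-- **At strong coupling the cold-pressure length is at most `8`** — by name from the tree: the Kotecký–Preiss rung
`Missing.coldFreeEnergyBound_of_strongCoupling` (`(m, K, t₀) = (1/4, 48e, 0)` on every spatial torus, for
`0 ≤ β ≤ strongCouplingRadius ρ`), `Missing.coldTraceBound_of_coldFreeEnergyBound` (rate `m/2 = 1/8`, volume-free
constant) and `Sufficient.coldPressureBound_of_coldTraceBound` (`S₀ = 0`).  Shows the statement FORMAT of stub I_cp is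
right; the content of I_cp is the same bound for all LARGE `β`, where simplicity of `G` must enter. [folklore] -/
theorem coldPressureAt_strongCoupling (r : LatticeRep G) {β : ℝ} (hβ0 : 0 ≤ β)
    (hβ : β ≤ strongCouplingRadius r.ρ) : ColdPressureAt r.ρ β 8 := by
  set K : ℝ := 48 * Real.exp 1 with hKdef
  set A : ℝ := 3072 * K / (1 / 4 : ℝ) ^ 3 * Real.exp (3072 * K / (1 / 4 : ℝ) ^ 3) with hAdef
  have hK0 : 0 ≤ K := by positivity
  have hA0 : 0 ≤ A := by positivity
  refine ⟨A / ((2 * 0 + 1 : ℕ) : ℝ) ^ 3, 0, by positivity, fun S _ => ?_⟩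
  have hF : ColdFreeEnergyBound r.ρ β (2 * S + 1) (1 / 4) K 0 :=
    coldFreeEnergyBound_of_strongCoupling r.ρ r.continuous r.mem_unitary hβ0 hβ (2 * S + 1)
  have hT : ColdTraceBound r.ρ β S (1 / 4 / 2) A :=
    coldTraceBound_of_coldFreeEnergyBound r.ρ (by norm_num) hK0 (by omega) hF
  have hT' : ColdTraceBound r.ρ β S (1 / ((8 : ℕ) : ℝ)) A := by
    have h8 : (1 / 4 / 2 : ℝ) = 1 / ((8 : ℕ) : ℝ) := by norm_num
    rw [← h8]
    exact hT
  exact coldPressureBound_of_coldTraceBound hT' hA0 (Nat.zero_le S)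

end Rung

/-! ## §4 THE HONEST REPAIR: the free-energy currency buys the simply-connected half; the rest is a flux-sector problem

`IR` splits by cases on `SimplyConnectedSpace G` (kernel-trivial).  For `π₁(G) = 1` (SU(N), Sp(N), Spin(N), E₆…:
no magnetic flux sectors on the periodic torus; torelons cost `σ_lat·(2S+1) → ∞` at fixed `β`, absorbed by `S₁`) the
cold-pressure pincer stands: `ColdPressureOnsetSC ∧ AFToColdPressure ⇒ IRsc` (PROVED composition).  For `π₁(G) ≠ 1`
the periodic trace carries `|π₁(G)|³` light flux vacua; the currency must be refined to SECTOR-RESOLVED cold pressure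
(`x_t − Σ_{i<q} rᵢᵗ ≤ C₀V³e^{−t/ξ}`) plus BLINDNESS of local observables on the light multiplet — a `q > 1`
generalisation of the landed trace-norm seam that is NOT in the tree; `IRnsc` below is the crux restricted, no claim. -/

section Repair

/-- The case split is kernel-trivial. -/
theorem IR_of_cases (h₁ : IRsc) (h₂ : IRnsc) : Summit.QuantumFields.YangMills.Theses.BalabanLadder.IR := by
  intro G _ _ _ _ hG
  by_cases hsc : SimplyConnectedSpace G
  · exact h₁ G hG hsc
  · exact h₂ G hG hsc

/-- **Composition on the simply-connected half (real proof).** -/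
theorem IRsc_of_cp (hI : ColdPressureOnsetSC) (hX : AFToColdPressure) : IRsc := by
  intro G _ _ _ _ hG hsc
  letI : MeasurableSpace G := borel G
  haveI : BorelSpace G := ⟨rfl⟩
  intro r a ha ha0 hlb
  obtain ⟨β₂, hon⟩ := hI G hG hsc r
  obtain ⟨T, β₆, hpin⟩ := cp_pinned r a ha hlb (hX G hG r)
  exact gapInUnits_of_coldPressure_pinned r a ha ha0 hon hpin

/-- **The repaired line concludes `IR` BY NAME from three stubs** (`I_cp^{sc}`, `X_cp`, and the flux-sector half
`IRnsc` — the last is the crux restricted, carried honestly as open). -/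
theorem IR_of_cp_repaired (hI : ColdPressureOnsetSC) (hX : AFToColdPressure) (hN : IRnsc) :
    Summit.QuantumFields.YangMills.Theses.BalabanLadder.IR :=
  IR_of_cases (IRsc_of_cp hI hX) hN

end Repair

end Summit.QuantumFields.YangMills.Cruxes.IR.ColdPressurePincer

end
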